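import Summits.QuantumFields.BalabanUV.Beta.FP.ConstrainedBiLaplacianResponseFull

/-!
# `BalabanUV.Beta.FP.ConstrainedBiLaplacianSbFull` — road «FP» for binder row D1, DESIGN ROW **GHOST-STEP** brick (g3) «(CONV-C)-Sb»,
# FILE 5a — THE OFFSET-PAIR MULTIPLIER OF THE COMPRESSED INVERSE READ AT A FINE LEFT POINT OF `ℤ^{d+1}`: the co-vector symbol `CsigSym`
# (strip-regular), the full-phase multiplier `Sfull` and its kernel `KS`, the DIAGONAL SUM (discrete orthogonality), and the symbol identities
# under `(−Δ)²` (unit-force row) and the block sum (zero)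

NOT IN PRINT; OUR PROOF ATTEMPT (binder row G-an2-4 ∕ (CONV-C), prover part P3 = fibre∕strip «Woodbury» lineage, gen 28; CRUX TEAM (2),
2026-08-21).  HONEST DEPENDENCY (cell records, verbatim): «continuum YM on T⁴ ⇐ BetaPertH ∧ nine spine estimates (0/9 proved); BetaPertH ⇐ (D1) ∧
(D4) ∧ CAP+tail; G-an2-4 gates asym, D1 and NE2/3/4.»  HONEST FRAMING (cell contract, verbatim): «discharging `BetaPertH` makes Bałaban's UV
stability UNCONDITIONAL — a real constructive-QFT result; it is NOT the continuum limit and NOT the Clay problem.»  ABSOLUTE RULE (cell charter,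
verbatim): «No internally-minted statement may enter as a cited fact. Every hypothesis is either kernel-proved in this package or a verbatim quotation
of a PUBLISHED theorem with page reference. The manuscript(s) under audit are NOT citable for their own disputed steps — they are the thing under
adjudication; programme-internal (2001/route/tribunal) claims are never citable.»  THIS MODULE is [folklore] lattice Fourier bookkeeping over the vendored `B4Green244` §2–§5
calculus (`PhZ`, `PhZ_finePt`, `sum_rootOfUnity_pow`, …), FILES 2, 3b and 4a of this programme (`cvec`, `symbol_mul_Gfib`, `sum_Fc_mul_Gfib`, `M`,
`negLap_sum_PhZ`, `sum_finePt_PhZ`); it cites nothing as a hypothesis, has THREE bookkeeping `def`s (`CsigSym`, `Sfull`, `KS`), no `def … : Prop`, no `sorry`.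

## Contents (dimension `d+1`; blocks of side `N ≥ 1`)

* §1 **`CsigSym n s σ = Σ_{k′} EFc(σ,k′)·cvec_{k′}`** (the multiplier of the block-constant Lagrange term of the compressed inverse's Euler–Lagrange
  row): holomorphy, side periodicity, `norm_CsigSym_le ≤ 2^d·CG·SW`, **`stripRegular_CsigSym`**.
* §2 **`Sfull N s z σ = Σ_k PhZ_k(z)·(N^{−(d+1)}·Σ_{k′} EFc(σ,k′)·Gfib k k′)`** (`Sfull_finePt`: `= e^{ip′·⌊z∕N⌋}·M N s (z mod N) σ`), the kernel
  **`KS N s z z′ := latticeKernel (M N s (z mod N) (z′ mod N)) (⌊z∕N⌋ − ⌊z′∕N⌋) = latticeKernel (Sfull N s z (z′ mod N)) (−⌊z′∕N⌋)`** (`KS_eq`),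
  holomorphy on the zone; `ef_mul_efc`, `sum_ef_mul_efc`, **`diag_sum`** (`N^{−(d+1)}·Σ_k PhZ_k(N•x+τ)·EFc(σ,k) = [τ = σ]·e^{ip′·x}`).
* §3 **`negLap_negLap_Sfull`** (`(−Δ)²_z Sfull = N^{−(d+1)}·Σ_k PhZ_k(z)·EFc(σ,k) − N^{−(d+1)}·e^{ip′·⌊z∕N⌋}·CsigSym N 2 σ` on the strip — FILE 2's
  unit-force row `symbol_mul_Gfib` + `sum_PhZ_F_zero`) and **`sum_finePt_Sfull`** (`Σ_j Sfull N s (N•y+j) σ = 0` — FILE 2's zero block sums).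

The junction with an2's `BiLaplaceBlockKKT.Sb` ∕ `Wb` is FILE 5b.  0∕4 row-D1 binders touched.  NOT (CONV-C), NEVER «G-an2-4 closed», NOT the ghost step
law, NOT SDF, NOT D1, NOT BetaPertH, NOT continuum, NOT Clay.  Provenance: prover-b2b-balaban-gan24-p3-g28-0 (unit `b2b-balaban-gan24-p3`, gen 28),
2026-08-21; no existing file touched.
-/

noncomputable section

namespace Summit.QuantumFields.BalabanUV.Beta.FP.ConstrainedBiLaplacianSbFull

open Complex Finset ComplexConjugate MeasureTheory
open Literature.MathematicalPhysics.QuantumFieldTheory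
open Literature.MathematicalPhysics.QuantumFieldTheory.Balaban1983to89
open Literature.MathematicalPhysics.QuantumFieldTheory.Balaban1983to89.B4Strip
open Literature.MathematicalPhysics.QuantumFieldTheory.Balaban1983to89.B4StripCauchy
open Literature.MathematicalPhysics.QuantumFieldTheory.Balaban1983to89.B5Strip145Analytic
open Literature.MathematicalPhysics.QuantumFieldTheory.Balaban1983to89.B5Strip145Decay
open Literature.MathematicalPhysics.QuantumFieldTheory.Balaban1983to89.B4StripSums
open Literature.MathematicalPhysics.QuantumFieldTheory.Balaban1983to89.B4StripSumsHolder (PhZ efZ differentiableAt_PhZ)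
open Literature.MathematicalPhysics.QuantumFieldTheory.Balaban1983to89.B4ContourShift
open Literature.MathematicalPhysics.QuantumFieldTheory.Balaban1983to89.B4Green244 (e coarse offset finePt finePt_coarse_offset coarse_finePt
  phaseC V F_zero PhZ_finePt lap_PhZ sum_PhZ_V negLap blockAvg opD opD_latticeKernel latticeKernel_phase_mul latticeKernel_congr
  latticeKernel_sum_mul latticeKernel_one latticeKernel_phase integrableOn_of_differentiableAt sum_rootOfUnity_pow)
open Summit.QuantumFields.BalabanUV.Beta.FP.ConstrainedBiLaplacianStrip
open Summit.QuantumFields.BalabanUV.Beta.FP.ConstrainedBiLaplacianFibre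
open Summit.QuantumFields.BalabanUV.Beta.FP.ConstrainedBiLaplacianFibreEntries
open Summit.QuantumFields.BalabanUV.Beta.FP.ConstrainedBiLaplacianFibreSides
open Summit.QuantumFields.BalabanUV.Beta.FP.ConstrainedBiLaplacianKernel
open Summit.QuantumFields.BalabanUV.Beta.FP.ConstrainedBiLaplacianFibreIdentities
open Summit.QuantumFields.BalabanUV.Beta.FP.ConstrainedBiLaplacianResponse
open Summit.QuantumFields.BalabanUV.Beta.FP.ConstrainedBiLaplacianResponseFull (ofRealVec_mem_strip differentiableAt_sum_PhZ negLap_sum_PhZ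
  sum_PhZ_F_zero sum_finePt_PhZ codiff₁_dz_eq_negLap negLap_const_mul negLap_eq_opD blockSum_eq_sum_finePt)
open Literature.MathematicalPhysics.QuantumFieldTheory.Balaban1983to89.B4Green242Bridge (latticeKernel_const_mul)
open Literature.MathematicalPhysics.QuantumFieldTheory.Balaban1983to89.Beta.AffineAveraging (Site Form0 dz codiff₁ unitVec box toSite blockSum)
open scoped Real

variable {d : ℕ}

/-! ## §1 The co-vector symbol -/

/-- [folklore] **THE CO-VECTOR SYMBOL** at the right offset `σ`: `CsigSym n s σ p′ = Σ_{k′} EFc(σ,k′)·cvec_{k′}` — the multiplier of the block-constant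
Lagrange term of the compressed inverse's Euler–Lagrange row. -/
def CsigSym (n : ℕ) [NeZero n] (s : ℕ) (σ : Fin d → Fin n) (p : Fin d → ℂ) : ℂ :=
  ∑ k' : Fin d → Fin n, EFc n σ k' p * cvec n s p k'

/-- [folklore] Holomorphy of the co-vector symbol on the strip. -/
theorem differentiableAt_CsigSym (n : ℕ) [NeZero n] (s : ℕ) (σ : Fin d → Fin n) {p : Fin d → ℂ} (hp : p ∈ Strip d (kappaB d s)) :
    DifferentiableAt ℂ (CsigSym n s σ) p := by
  show DifferentiableAt ℂ (fun q => ∑ k' : Fin d → Fin n, EFc n σ k' q * cvec n s q k') p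
  apply DifferentiableAt.fun_sum; intro k' _
  exact (differentiableAt_EFc n σ k' p).mul (differentiableAt_cvec n s k' hp)

/-- [folklore] Side periodicity of the co-vector symbol. -/
theorem CsigSym_tr_side (n : ℕ) [NeZero n] (s : ℕ) {κ : ℝ} (hκ0 : 0 ≤ κ) (hκ : κ ≤ kappaB d s) {p : Fin d → ℂ} (hp : p ∈ Strip d κ)
    (μ : Fin d) (hre : (p μ).re = -Real.pi) (σ : Fin d → Fin n) : CsigSym n s σ (tr p μ) = CsigSym n s σ p := by
  unfold CsigSym
  calc ∑ k' : Fin d → Fin n, EFc n σ k' (tr p μ) * cvec n s (tr p μ) k'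
      = ∑ k' : Fin d → Fin n, EFc n σ (sigma n μ k') p * cvec n s p (sigma n μ k') := by
        refine Finset.sum_congr rfl fun k' _ => ?_
        rw [EFc_tr, cvec_tr_side n s hκ0 hκ hp μ hre]
    _ = ∑ k' : Fin d → Fin n, EFc n σ k' p * cvec n s p k' :=
        Equiv.sum_comp (sigmaEquiv n μ) (fun k' => EFc n σ k' p * cvec n s p k')

/-- [folklore] `‖CsigSym n s σ p′‖ ≤ 2^d·CG d s·SW n d s` on the strip. -/
theorem norm_CsigSym_le (n : ℕ) [NeZero n] (s : ℕ) (σ : Fin d → Fin n) {p : Fin d → ℂ} (hp : p ∈ Strip d (kappaB d s)) :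
    ‖CsigSym n s σ p‖ ≤ 2 ^ d * CG d s * SW n d s := by
  have hfat : p ∈ Fat d (rOf d) := fat_of_strip s hp
  have hCG := CG_nonneg d s
  have hterm : ∀ k : Fin d → Fin n, ‖EFc n σ k p * cvec n s p k‖ ≤ 2 ^ d * (CG d s * wt n s k) := fun k => by
    rw [norm_mul]
    exact mul_le_mul (norm_EFc_le n (rOf_le d) σ k hfat) (norm_cvec_le n s hp k) (norm_nonneg _) (by positivity)
  unfold CsigSym
  calc ‖∑ k : Fin d → Fin n, EFc n σ k p * cvec n s p k‖
      ≤ ∑ k : Fin d → Fin n, ‖EFc n σ k p * cvec n s p k‖ := norm_sum_le _ _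
    _ ≤ ∑ k : Fin d → Fin n, 2 ^ d * (CG d s * wt n s k) := Finset.sum_le_sum fun k _ => hterm k
    _ = 2 ^ d * CG d s * SW n d s := by
        unfold SW
        rw [Finset.mul_sum]
        refine Finset.sum_congr rfl fun k _ => ?_
        ring

/-- [folklore] **STRIP REGULARITY OF THE CO-VECTOR SYMBOL** (dimension `d+1`). -/
theorem stripRegular_CsigSym (n : ℕ) [NeZero n] (s : ℕ) (σ : Fin (d + 1) → Fin n) :
    StripRegular (d := d) (CsigSym n s σ) (kappaB (d + 1) s) (2 ^ (d + 1) * CG (d + 1) s * SW n (d + 1) s) := by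
  have hκ0 : 0 ≤ kappaB (d + 1) s := (kappaB_pos (d + 1) s).le
  have hdiffAt : ∀ p ∈ Strip (d + 1) (kappaB (d + 1) s), DifferentiableAt ℂ (CsigSym n s σ) p := fun p hp =>
    differentiableAt_CsigSym n s σ hp
  refine ⟨?_, ?_, ?_, ?_⟩
  · exact fun p hp => (hdiffAt p hp).continuousAt.continuousWithinAt
  · intro i q hq z hz
    have hP : i.insertNth z (ofRealVec q) ∈ Strip (d + 1) (kappaB (d + 1) s) :=
      insertNth_mem_Strip hκ0 i hq (openRect_subset_closedRect _ hz)
    exact ((hdiffAt _ hP).comp z (differentiableAt_insertNth i _ z)).differentiableWithinAt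
  · intro i q hq y hy
    obtain ⟨hP, hre⟩ := insertNth_left_mem hκ0 i hq hy
    rw [← tr_insertNth_left]
    exact (CsigSym_tr_side n s hκ0 le_rfl hP i hre σ).symm
  · intro p hp
    exact norm_CsigSym_le n s σ hp

/-! ## §2 The full-phase multiplier of the compressed inverse, its kernel, the diagonal sum -/

/-- [folklore] **THE OFFSET-PAIR MULTIPLIER READ AT THE FINE LEFT POINT `z`** (right offset `σ`):
`Sfull N s z σ p′ = Σ_k PhZ_k(z)·(N^{−(d+1)}·Σ_{k′} EFc(σ,k′)·Gfib k k′)`. -/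
def Sfull (N : ℕ) [NeZero N] (s : ℕ) (z : Fin (d + 1) → ℤ) (σ : Fin (d + 1) → Fin N) (p : Fin (d + 1) → ℂ) : ℂ :=
  ∑ k : Fin (d + 1) → Fin N, PhZ N k z p *
    ((((N : ℂ) ^ (d + 1))⁻¹) * ∑ k' : Fin (d + 1) → Fin N, EFc N σ k' p * Gfib N s k k' p)

/-- [folklore] `Sfull (N x⁰ + τ) σ = e^{ip′·x⁰}·M N s τ σ`. -/
theorem Sfull_finePt (N : ℕ) [NeZero N] (s : ℕ) (x : Fin (d + 1) → ℤ) (j σ : Fin (d + 1) → Fin N) (P : Fin (d + 1) → ℂ) :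
    Sfull N s (finePt N x j) σ P = cexp (I * phaseC P x) * M N s j σ P := by
  unfold Sfull M EF
  rw [Finset.mul_sum, Finset.mul_sum]
  refine Finset.sum_congr rfl fun k _ => ?_
  rw [PhZ_finePt N (NeZero.ne N), Finset.mul_sum, Finset.mul_sum, Finset.mul_sum, Finset.mul_sum]
  refine Finset.sum_congr rfl fun k' _ => ?_
  ring

/-- [folklore] **THE POSITION-SPACE KERNEL OF THE COMPRESSED INVERSE** (block units): `KS N s z z′ := latticeKernel (M N s (z mod N) (z′ mod N)) (⌊z∕N⌋ − ⌊z′∕N⌋)`. -/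
def KS (N : ℕ) [NeZero N] (s : ℕ) (z z' : Fin (d + 1) → ℤ) : ℂ :=
  latticeKernel (M N s (offset N z) (offset N z')) (coarse N z - coarse N z')

/-- [folklore] `KS N s z z′ = latticeKernel (Sfull N s z (offset N z′)) (−coarse N z′)`. -/
theorem KS_eq (N : ℕ) [NeZero N] (s : ℕ) (z z' : Fin (d + 1) → ℤ) :
    KS N s z z' = latticeKernel (Sfull N s z (offset N z')) (-coarse N z') := by
  have hz : Sfull N s z (offset N z') = fun P => cexp (I * phaseC P (coarse N z)) * M N s (offset N z) (offset N z') P := by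
    funext P
    rw [← Sfull_finePt, finePt_coarse_offset]
  rw [hz, latticeKernel_phase_mul, KS, neg_add_eq_sub]

/-- [folklore] The inner coefficient of `Sfull` is holomorphic on the strip. -/
theorem differentiableAt_inner (N : ℕ) [NeZero N] (s : ℕ) (σ : Fin (d + 1) → Fin N) (k : Fin (d + 1) → Fin N)
    {P : Fin (d + 1) → ℂ} (hP : P ∈ Strip (d + 1) (kappaB (d + 1) s)) :
    DifferentiableAt ℂ (fun Q => (((N : ℂ) ^ (d + 1))⁻¹) * ∑ k' : Fin (d + 1) → Fin N, EFc N σ k' Q * Gfib N s k k' Q) P := by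
  apply DifferentiableAt.const_mul
  apply DifferentiableAt.fun_sum; intro k' _
  exact (differentiableAt_EFc N σ k' P).mul (differentiableAt_Gfib N s k k' hP)

/-- [folklore] `Sfull N s z σ` is holomorphic at every point of the real zone. -/
theorem differentiableAt_Sfull (N : ℕ) [NeZero N] (s : ℕ) (z : Fin (d + 1) → ℤ) (σ : Fin (d + 1) → Fin N) (p : Fin (d + 1) → ℝ)
    (hp : p ∈ BZ (d + 1)) : DifferentiableAt ℂ (Sfull N s z σ) (ofRealVec p) :=
  differentiableAt_sum_PhZ N s _ (fun k _ hP => differentiableAt_inner N s σ k hP) z p hp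

/-- [folklore] `ef·efc` at a common residue: `ef n j t z · efc n j u z = e^{iz(t−u)∕n}·(e^{2πi(t−u)∕n})^j`. -/
theorem ef_mul_efc (n j t u : ℕ) (hn : n ≠ 0) (z : ℂ) :
    ef n j t z * efc n j u z = cexp (I * z * ((t : ℂ) - u) / n) * cexp (2 * π * I * ((t : ℂ) - u) / n) ^ j := by
  unfold ef efc
  rw [← Complex.exp_nat_mul, ← Complex.exp_add, ← Complex.exp_add]
  congr 1
  have hn' : (n : ℂ) ≠ 0 := Nat.cast_ne_zero.mpr hn
  field_simp
  ring

/-- [folklore] One coordinate of the diagonal sum: `Σ_{j<n} ef n j t z · efc n j u z = [t = u]·n` for residues `t, u < n`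
(`B4Green244.sum_rootOfUnity_pow`). -/
theorem sum_ef_mul_efc (n t u : ℕ) (hn : n ≠ 0) (ht : t < n) (hu : u < n) (z : ℂ) :
    ∑ j ∈ Finset.range n, ef n j t z * efc n j u z = if t = u then (n : ℂ) else 0 := by
  simp_rw [ef_mul_efc n _ t u hn z]
  rw [← Finset.mul_sum, sum_rootOfUnity_pow n t u hn ht hu]
  by_cases h : t = u
  · subst h
    simp
  · rw [if_neg (fun h' => h h'.symm), if_neg h, mul_zero]

/-- [folklore] **THE DIAGONAL SUM** (discrete orthogonality of the fine phases against the conjugate offset phases):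
`N^{−(d+1)}·Σ_k PhZ_k(N•x + τ)·EFc(σ,k) = [τ = σ]·e^{ip′·x}`. -/
theorem diag_sum (N : ℕ) [NeZero N] (x : Fin (d + 1) → ℤ) (τ σ : Fin (d + 1) → Fin N) (P : Fin (d + 1) → ℂ) :
    (((N : ℂ) ^ (d + 1))⁻¹) * ∑ k : Fin (d + 1) → Fin N, PhZ N k (finePt N x τ) P * EFc N σ k P
      = if τ = σ then cexp (I * phaseC P x) else 0 := by
  have hN : N ≠ 0 := NeZero.ne N
  have hNC : ((N : ℂ) ^ (d + 1)) ≠ 0 := pow_ne_zero _ (Nat.cast_ne_zero.mpr hN)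
  simp_rw [PhZ_finePt N hN]
  unfold EFc
  simp_rw [mul_assoc, ← Finset.prod_mul_distrib]
  rw [← Finset.mul_sum]
  have h := Finset.prod_univ_sum (fun _ : Fin (d + 1) => (Finset.univ : Finset (Fin N)))
    (fun ν i => ef N (i : ℕ) (τ ν : ℕ) (P ν) * efc N (i : ℕ) (σ ν : ℕ) (P ν))
  rw [Fintype.piFinset_univ] at h
  rw [← h]
  have h1 : ∀ ν : Fin (d + 1), ∑ i : Fin N, ef N (i : ℕ) (τ ν : ℕ) (P ν) * efc N (i : ℕ) (σ ν : ℕ) (P ν)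
      = if (τ ν : ℕ) = (σ ν : ℕ) then (N : ℂ) else 0 := fun ν => by
    rw [Fin.sum_univ_eq_sum_range (fun i => ef N i (τ ν : ℕ) (P ν) * efc N i (σ ν : ℕ) (P ν)) N]
    exact sum_ef_mul_efc N _ _ hN (τ ν).isLt (σ ν).isLt (P ν)
  simp_rw [h1]
  by_cases hτ : τ = σ
  · subst hτ
    simp only [if_true, Finset.prod_const, Finset.card_univ, Fintype.card_fin]
    field_simp
  · rw [if_neg hτ]
    have : ∃ ν, (τ ν : ℕ) ≠ (σ ν : ℕ) := by
      by_contra hall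
      apply hτ
      funext ν
      apply Fin.ext
      by_contra hν
      exact hall ⟨ν, hν⟩
    obtain ⟨ν, hν⟩ := this
    rw [Finset.prod_eq_zero (Finset.mem_univ ν) (by rw [if_neg hν]), mul_zero, mul_zero]

/-! ## §3 The symbol identities on the strip -/

variable (N : ℕ) [NeZero N]

/-- [folklore] **`(−Δ)²` ON THE COMPRESSED-INVERSE MULTIPLIER ON THE STRIP** (`s = 2`; FILE 2's `symbol_mul_Gfib` + `sum_PhZ_F_zero`):
`negLap N (negLap N (Sfull N 2 · σ)) z = N^{−(d+1)}·Σ_k PhZ_k(z)·EFc(σ,k) − N^{−(d+1)}·e^{ip′·⌊z∕N⌋}·CsigSym N 2 σ`. -/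
theorem negLap_negLap_Sfull (z : Fin (d + 1) → ℤ) (σ : Fin (d + 1) → Fin N) {P : Fin (d + 1) → ℂ}
    (hP : P ∈ Strip (d + 1) (kappaB (d + 1) 2)) :
    negLap N (negLap N (fun z' => Sfull N 2 z' σ P)) z
      = (((N : ℂ) ^ (d + 1))⁻¹) * (∑ k : Fin (d + 1) → Fin N, PhZ N k z P * EFc N σ k P)
        - (((N : ℂ) ^ (d + 1))⁻¹) * cexp (I * phaseC P (coarse N z)) * CsigSym N 2 σ P := by
  set c : (Fin (d + 1) → Fin N) → ℂ := fun k => (((N : ℂ) ^ (d + 1))⁻¹) * ∑ k' : Fin (d + 1) → Fin N, EFc N σ k' P * Gfib N 2 k k' P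
    with hc
  have h1 : negLap N (fun z' => Sfull N 2 z' σ P) = fun z' => ∑ k : Fin (d + 1) → Fin N, PhZ N k z' P * (DeltaXi N 0 (shift N k P) * c k) := by
    funext z'; exact negLap_sum_PhZ N c z' P
  rw [h1, negLap_sum_PhZ]
  have h2 : ∀ k : Fin (d + 1) → Fin N, DeltaXi N 0 (shift N k P) * (DeltaXi N 0 (shift N k P) * c k)
      = (((N : ℂ) ^ (d + 1))⁻¹) * (EFc N σ k P - F N (fun _ => 0) k P * CsigSym N 2 σ P) := fun k => by
    have hrow : ∀ k', DeltaXi N 0 (shift N k P) ^ 2 * Gfib N 2 k k' P = (if k = k' then 1 else 0) - F N (fun _ => 0) k P * cvec N 2 P k' :=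
      fun k' => symbol_mul_Gfib N 2 hP k k'
    have e0 : DeltaXi N 0 (shift N k P) * (DeltaXi N 0 (shift N k P) * c k)
        = (((N : ℂ) ^ (d + 1))⁻¹) * ∑ k' : Fin (d + 1) → Fin N, EFc N σ k' P * (DeltaXi N 0 (shift N k P) ^ 2 * Gfib N 2 k k' P) := by
      rw [hc]
      simp only []
      rw [Finset.mul_sum, Finset.mul_sum, Finset.mul_sum, Finset.mul_sum]
      refine Finset.sum_congr rfl fun k' _ => ?_
      ring
    rw [e0]
    congr 1
    have e1 : ∀ k', EFc N σ k' P * (DeltaXi N 0 (shift N k P) ^ 2 * Gfib N 2 k k' P)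
        = (if k = k' then EFc N σ k' P else 0) - F N (fun _ => 0) k P * (EFc N σ k' P * cvec N 2 P k') := fun k' => by
      rw [hrow k']
      split_ifs <;> ring
    rw [Finset.sum_congr rfl (fun k' _ => e1 k'), Finset.sum_sub_distrib, Finset.sum_ite_eq Finset.univ k (fun k' => EFc N σ k' P),
      if_pos (Finset.mem_univ k), ← Finset.mul_sum]
    rfl
  simp_rw [h2]
  have h3 : ∀ k : Fin (d + 1) → Fin N, PhZ N k z P * ((((N : ℂ) ^ (d + 1))⁻¹) * (EFc N σ k P - F N (fun _ => 0) k P * CsigSym N 2 σ P))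
      = (((N : ℂ) ^ (d + 1))⁻¹) * (PhZ N k z P * EFc N σ k P)
        - (((N : ℂ) ^ (d + 1))⁻¹) * CsigSym N 2 σ P * (PhZ N k z P * F N (fun _ => 0) k P) := fun k => by ring
  rw [Finset.sum_congr rfl (fun k _ => h3 k), Finset.sum_sub_distrib, ← Finset.mul_sum, ← Finset.mul_sum, sum_PhZ_F_zero]
  ring

/-- [folklore] **THE BLOCK SUM OF THE COMPRESSED-INVERSE MULTIPLIER ON THE STRIP VANISHES**: `Σ_j Sfull N s (N•y + j) σ p′ = 0`
(`sum_finePt_PhZ` + FILE 2's `sum_Fc_mul_Gfib`). -/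
theorem sum_finePt_Sfull (s : ℕ) (y : Fin (d + 1) → ℤ) (σ : Fin (d + 1) → Fin N) {P : Fin (d + 1) → ℂ}
    (hP : P ∈ Strip (d + 1) (kappaB (d + 1) s)) : ∑ j : Fin (d + 1) → Fin N, Sfull N s (finePt N y j) σ P = 0 := by
  have hNC : ((N : ℂ) ^ (d + 1)) ≠ 0 := pow_ne_zero _ (Nat.cast_ne_zero.mpr (NeZero.ne N))
  unfold Sfull
  rw [Finset.sum_comm]
  have h1 : ∀ k : Fin (d + 1) → Fin N,
      ∑ j : Fin (d + 1) → Fin N, PhZ N k (finePt N y j) P * ((((N : ℂ) ^ (d + 1))⁻¹) * ∑ k' : Fin (d + 1) → Fin N, EFc N σ k' P * Gfib N s k k' P)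
        = cexp (I * phaseC P y) * ∑ k' : Fin (d + 1) → Fin N, EFc N σ k' P * (Fc N (fun _ => 0) k P * Gfib N s k k' P) := fun k => by
    rw [← Finset.sum_mul, sum_finePt_PhZ, Finset.mul_sum, Finset.mul_sum, Finset.mul_sum]
    refine Finset.sum_congr rfl fun k' _ => ?_
    field_simp
  rw [Finset.sum_congr rfl (fun k _ => h1 k), ← Finset.mul_sum, Finset.sum_comm]
  have h2 : ∀ k' : Fin (d + 1) → Fin N, ∑ k : Fin (d + 1) → Fin N, EFc N σ k' P * (Fc N (fun _ => 0) k P * Gfib N s k k' P) = 0 := fun k' => by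
    rw [← Finset.mul_sum, sum_Fc_mul_Gfib N s hP k', mul_zero]
  rw [Finset.sum_congr rfl (fun k' _ => h2 k'), Finset.sum_const_zero, mul_zero]

end Summit.QuantumFields.BalabanUV.Beta.FP.ConstrainedBiLaplacianSbFull

end
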